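import Literature.Analysis.FluidPDE.CompressibleEulerPrimitiveForm
import HarnessLib

/-!
# The `L²` energy identity of the linearised symmetric Euler (acoustic) system on `𝕋^d`

Analysis/FluidPDE support file (everything proved), layer L6a of the programme to discharge
`Literature.Analysis.FluidPDE.CompressibleEulerLocalWellPosedness` (Majda 1984, Ch. 2,
Thms 2.1–2.2). Every energy estimate of the local theory of the complete Euler system — the
uniqueness of classical solutions, the low-norm contraction of the iteration scheme, and (after
differentiating the equations) the high-norm bounds — is the `L²` energy identity of ONE linear
system with variable coefficients, the linearisation of the primitive Euler system
(`CompressibleEulerPrimitiveForm.lean`) in the symmetrised form of Majda 1984, Ch. 1 /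
Dafermos 2005, (5.1.11)–(5.1.15): for unknowns `(r, w, θ)` (scalar, vector, scalar) on `S × 𝕋^d`
and given coefficient fields `v` (velocity), `a, b, c, g`, the RESIDUALS

  `R₁ = ∂ₜr + v·∇r + c div w`, `R₂ = ∂ₜw + (v·∇)w + a ∇r + b ∇θ`, `R₃ = ∂ₜθ + v·∇θ + g div w`

and the energy density `e = a r² + c |w|² + d₃ θ²` with weights `(a, c, d₃)`, `d₃ g = c b`
(for the monatomic fluid linearised at `(ρ, u, ϑ)`: `v = u`, `a = ϑ(ρζ)'(ρ)/ρ`, `b = ζ(ρ)`,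
`c = ρ`, `g = (2/3)ϑζ(ρ)`, `d₃ = 3ρ/(2ϑ)` — Majda's `diag(p_ρ/ρ, ρI, ρe_ϑ/ϑ)`). This file proves,
for ARBITRARY jointly smooth fields (no equation is assumed; the residuals are just names for
the displayed expressions):

* `transport_sq_identity` — `2 a r (v·∇r) = div(a r² v) - r² div(a v)`;
* `transport_norm_sq_identity` — `2 c ⟪w, (v·∇)w⟫ = div(c|w|² v) - |w|² div(c v)`;
* `cross_identity` — `m (r div w + w·∇r) = div(m r w) - r (w·∇m)`;
* `linearizedEnergy_pointwise` — the pointwise identity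
  `∂ₜe = 2 a r R₁ + 2 c ⟪w, R₂⟫ + 2 d₃ θ R₃ + (∂ₜa) r² + (∂ₜc)|w|² + (∂ₜd₃) θ²`
  ` + r² div(a v) + |w|² div(c v) + θ² div(d₃ v) + 2 r (w·∇(ac)) + 2 θ (w·∇(d₃ g))`
  ` - div(a r² v) - div(c |w|² v) - div(d₃ θ² v) - 2 div(a c r w) - 2 div(d₃ g θ w)`;
* `linearizedEnergy_hasDerivWithinAt` — integrated over `𝕋^d` (the divergences drop out,
  `Torus.integral_divergence_eq_zero`; differentiation under the integral sign within a convex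
  time set): `d/dt ∫ e = ∫ [2 a r R₁ + 2 c ⟪w, R₂⟫ + 2 d₃ θ R₃ + (zeroth-order terms)]`.

The zeroth-order terms are quadratic in `(r, w, θ)` with coefficients built from first
derivatives of the coefficient fields — this is the structure behind Dafermos (5.1.16)/(5.1.22)
and Majda's basic `L²` estimate; the Grönwall consequences are drawn in the files that use it.

## References

* A. Majda, *Compressible Fluid Flow and Systems of Conservation Laws in Several Space
  Variables*, Appl. Math. Sci. 53, Springer 1984, Ch. 1 (symmetrisation of the Euler system),
  Ch. 2 §2.1 (the basic energy estimate for symmetric hyperbolic systems). [`Majda1984`]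
* C. M. Dafermos, *Hyperbolic Conservation Laws in Continuum Physics*, 2nd ed. (2005), §5.1,
  (5.1.13)–(5.1.16), (5.1.19)–(5.1.22). [`Dafermos2005`]
-/

noncomputable section

open Set Function Filter MeasureTheory
open scoped ContDiff _root_.Topology InnerProductSpace

namespace Literature.Analysis.FluidPDE

namespace CompressibleEuler

open Literature.Analysis.FunctionSpaces

/-! ## Spatial identities on `𝕋^d` -/

section Spatial

variable {d : Type*} [Fintype d] [DecidableEq d]

/-- `∂ᵢ(r²) = 2 r ∂ᵢr` for `C¹` scalar `r` on the torus. [folklore] -/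
theorem partialDeriv_sq {r : UnitAddTorus d → ℝ} (hr : FunctionSpaces.Torus.IsContDiff 1 r) (i : d)
    (x : UnitAddTorus d) :
    FunctionSpaces.Torus.partialDeriv i (fun y => r y ^ 2) x =
      2 * r x * FunctionSpaces.Torus.partialDeriv i r x := by
  rw [show (fun y => r y ^ 2) = fun y => r y * r y from funext fun y => by ring,
    FunctionSpaces.Torus.partialDeriv_mul hr hr i x]
  ring

/-- `∂ᵢ(‖w‖²) = 2 ⟪w, ∂ᵢw⟫` for `C¹` `w` on the torus. [folklore] -/
theorem partialDeriv_norm_sq {G : Type*} [NormedAddCommGroup G] [InnerProductSpace ℝ G]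
    {w : UnitAddTorus d → G} (hw : FunctionSpaces.Torus.IsContDiff 1 w) (i : d) (x : UnitAddTorus d) :
    FunctionSpaces.Torus.partialDeriv i (fun y => ‖w y‖ ^ 2) x =
      2 * ⟪w x, FunctionSpaces.Torus.partialDeriv i w x⟫_ℝ := by
  have hw2 : FunctionSpaces.Torus.IsContDiff 1 (fun y => ‖w y‖ ^ 2) := hw.norm_sq ℝ
  rw [FunctionSpaces.Torus.partialDeriv_eq_fderiv_apply hw2,
    FunctionSpaces.Torus.fderiv_norm_sq_apply hw, ← FunctionSpaces.Torus.partialDeriv_eq_fderiv_apply hw]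

/-- **Transport identity for a weighted square**: `2 a r (v·∇r) = div(a r² v) - r² div(a v)`
pointwise, for `C¹` `a, r, v` (`v·∇r = ∑ᵢ vᵢ ∂ᵢr`). [folklore] -/
theorem transport_sq_identity {a r : UnitAddTorus d → ℝ} {v : UnitAddTorus d → EuclideanSpace ℝ d}
    (ha : FunctionSpaces.Torus.IsContDiff 1 a) (hr : FunctionSpaces.Torus.IsContDiff 1 r)
    (hv : FunctionSpaces.Torus.IsContDiff 1 v) (x : UnitAddTorus d) :
    2 * a x * r x * (∑ i, v x i * FunctionSpaces.Torus.partialDeriv i r x) =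
      FunctionSpaces.Torus.divergence (fun y => (a y * r y ^ 2) • v y) x -
        r x ^ 2 * FunctionSpaces.Torus.divergence (fun y => a y • v y) x := by
  have hr2 : FunctionSpaces.Torus.IsContDiff 1 (fun y => r y ^ 2) := hr.pow 2
  have har2 : FunctionSpaces.Torus.IsContDiff 1 (fun y => a y * r y ^ 2) := ha.mul hr2
  rw [FunctionSpaces.Torus.divergence_smul har2 hv x, FunctionSpaces.Torus.divergence_smul ha hv x]
  have h1 : ∑ i, v x i * FunctionSpaces.Torus.partialDeriv i (fun y => a y * r y ^ 2) x =
      a x * (2 * r x) * ∑ i, v x i * FunctionSpaces.Torus.partialDeriv i r x +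
        r x ^ 2 * ∑ i, v x i * FunctionSpaces.Torus.partialDeriv i a x := by
    simp_rw [FunctionSpaces.Torus.partialDeriv_mul ha hr2, partialDeriv_sq hr]
    rw [Finset.mul_sum, Finset.mul_sum, ← Finset.sum_add_distrib]
    exact Finset.sum_congr rfl fun i _ => by ring
  rw [h1]
  ring

/-- **Transport identity for a weighted squared norm**:
`2 c ∑ᵢ vᵢ ⟪w, ∂ᵢw⟫ = div(c‖w‖² v) - ‖w‖² div(c v)` pointwise, for `C¹` `c, w, v`. [folklore] -/
theorem transport_norm_sq_identity {G : Type*} [NormedAddCommGroup G] [InnerProductSpace ℝ G]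
    {c : UnitAddTorus d → ℝ} {w : UnitAddTorus d → G} {v : UnitAddTorus d → EuclideanSpace ℝ d}
    (hc : FunctionSpaces.Torus.IsContDiff 1 c) (hw : FunctionSpaces.Torus.IsContDiff 1 w)
    (hv : FunctionSpaces.Torus.IsContDiff 1 v) (x : UnitAddTorus d) :
    2 * c x * (∑ i, v x i * ⟪w x, FunctionSpaces.Torus.partialDeriv i w x⟫_ℝ) =
      FunctionSpaces.Torus.divergence (fun y => (c y * ‖w y‖ ^ 2) • v y) x -
        ‖w x‖ ^ 2 * FunctionSpaces.Torus.divergence (fun y => c y • v y) x := by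
  have hw2 : FunctionSpaces.Torus.IsContDiff 1 (fun y => ‖w y‖ ^ 2) := hw.norm_sq ℝ
  have hcw2 : FunctionSpaces.Torus.IsContDiff 1 (fun y => c y * ‖w y‖ ^ 2) := hc.mul hw2
  rw [FunctionSpaces.Torus.divergence_smul hcw2 hv x, FunctionSpaces.Torus.divergence_smul hc hv x]
  have h1 : ∑ i, v x i * FunctionSpaces.Torus.partialDeriv i (fun y => c y * ‖w y‖ ^ 2) x =
      c x * 2 * ∑ i, v x i * ⟪w x, FunctionSpaces.Torus.partialDeriv i w x⟫_ℝ +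
        ‖w x‖ ^ 2 * ∑ i, v x i * FunctionSpaces.Torus.partialDeriv i c x := by
    simp_rw [FunctionSpaces.Torus.partialDeriv_mul hc hw2, partialDeriv_norm_sq hw]
    rw [Finset.mul_sum, Finset.mul_sum, ← Finset.sum_add_distrib]
    exact Finset.sum_congr rfl fun i _ => by ring
  rw [h1]
  ring

/-- **Cross-term identity**: `m (r div w + w·∇r) = div(m r w) - r (w·∇m)` pointwise, for `C¹`
`m, r, w` — the symmetry of the acoustic coupling turns `r div w + w·∇r` into a divergence.
[folklore] -/
theorem cross_identity {m r : UnitAddTorus d → ℝ} {w : UnitAddTorus d → EuclideanSpace ℝ d}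
    (hm : FunctionSpaces.Torus.IsContDiff 1 m) (hr : FunctionSpaces.Torus.IsContDiff 1 r)
    (hw : FunctionSpaces.Torus.IsContDiff 1 w) (x : UnitAddTorus d) :
    m x * (r x * FunctionSpaces.Torus.divergence w x +
        ∑ i, w x i * FunctionSpaces.Torus.partialDeriv i r x) =
      FunctionSpaces.Torus.divergence (fun y => (m y * r y) • w y) x -
        r x * ∑ i, w x i * FunctionSpaces.Torus.partialDeriv i m x := by
  have hmr : FunctionSpaces.Torus.IsContDiff 1 (fun y => m y * r y) := hm.mul hr
  rw [FunctionSpaces.Torus.divergence_smul hmr hw x]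
  have h1 : ∑ i, w x i * FunctionSpaces.Torus.partialDeriv i (fun y => m y * r y) x =
      m x * ∑ i, w x i * FunctionSpaces.Torus.partialDeriv i r x +
        r x * ∑ i, w x i * FunctionSpaces.Torus.partialDeriv i m x := by
    simp_rw [FunctionSpaces.Torus.partialDeriv_mul hm hr]
    rw [Finset.mul_sum, Finset.mul_sum, ← Finset.sum_add_distrib]
    exact Finset.sum_congr rfl fun i _ => by ring
  rw [h1]
  ring

end Spatial

/-! ## The pointwise energy identity -/

section Pointwise

variable {d : Type*} [Fintype d] [DecidableEq d] {S : Set ℝ}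
  {r θ a b c g d₃ : ℝ → UnitAddTorus d → ℝ} {w v : ℝ → UnitAddTorus d → EuclideanSpace ℝ d}

omit [DecidableEq d] in
/-- The one-sided time derivative of the energy density `a r² + c‖w‖² + d₃θ²` of jointly smooth
fields (product rules). [folklore] -/
theorem timeDerivWithin_energyDensity (hr : FunctionSpaces.Torus.IsSmoothSpaceTimeOn S r)
    (hθ : FunctionSpaces.Torus.IsSmoothSpaceTimeOn S θ) (hw : FunctionSpaces.Torus.IsSmoothSpaceTimeOn S w)
    (ha : FunctionSpaces.Torus.IsSmoothSpaceTimeOn S a) (hc : FunctionSpaces.Torus.IsSmoothSpaceTimeOn S c)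
    (hd : FunctionSpaces.Torus.IsSmoothSpaceTimeOn S d₃) (hS : UniqueDiffOn ℝ S) {t : ℝ} (ht : t ∈ S)
    (x : UnitAddTorus d) :
    FunctionSpaces.Torus.timeDerivWithin S
        (fun s y => a s y * r s y ^ 2 + c s y * ‖w s y‖ ^ 2 + d₃ s y * θ s y ^ 2) t x =
      FunctionSpaces.Torus.timeDerivWithin S a t x * r t x ^ 2 +
          2 * a t x * r t x * FunctionSpaces.Torus.timeDerivWithin S r t x +
        (FunctionSpaces.Torus.timeDerivWithin S c t x * ‖w t x‖ ^ 2 +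
          2 * c t x * ⟪w t x, FunctionSpaces.Torus.timeDerivWithin S w t x⟫_ℝ) +
        (FunctionSpaces.Torus.timeDerivWithin S d₃ t x * θ t x ^ 2 +
          2 * d₃ t x * θ t x * FunctionSpaces.Torus.timeDerivWithin S θ t x) := by
  have ha' := ha.hasDerivWithinAt_slice ht x
  have hr' := hr.hasDerivWithinAt_slice ht x
  have hc' := hc.hasDerivWithinAt_slice ht x
  have hw' := (hw.hasDerivWithinAt_slice ht x).norm_sq
  have hd' := hd.hasDerivWithinAt_slice ht x
  have hθ' := hθ.hasDerivWithinAt_slice ht x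
  have hE : HasDerivWithinAt
      (fun τ => a τ x * (r τ x * r τ x) + c τ x * ‖w τ x‖ ^ 2 + d₃ τ x * (θ τ x * θ τ x))
      (FunctionSpaces.Torus.timeDerivWithin S a t x * (r t x * r t x) +
          a t x * (FunctionSpaces.Torus.timeDerivWithin S r t x * r t x +
            r t x * FunctionSpaces.Torus.timeDerivWithin S r t x) +
        (FunctionSpaces.Torus.timeDerivWithin S c t x * ‖w t x‖ ^ 2 +
          c t x * (2 * ⟪w t x, FunctionSpaces.Torus.timeDerivWithin S w t x⟫_ℝ)) +
        (FunctionSpaces.Torus.timeDerivWithin S d₃ t x * (θ t x * θ t x) +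
          d₃ t x * (FunctionSpaces.Torus.timeDerivWithin S θ t x * θ t x +
            θ t x * FunctionSpaces.Torus.timeDerivWithin S θ t x))) S t :=
    ((ha'.mul (hr'.mul hr')).add (hc'.mul hw')).add (hd'.mul (hθ'.mul hθ'))
  have hfun : (fun s y => a s y * r s y ^ 2 + c s y * ‖w s y‖ ^ 2 + d₃ s y * θ s y ^ 2) =
      fun s y => a s y * (r s y * r s y) + c s y * ‖w s y‖ ^ 2 + d₃ s y * (θ s y * θ s y) := by
    funext s y; ring
  rw [hfun, show FunctionSpaces.Torus.timeDerivWithin S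
      (fun s y => a s y * (r s y * r s y) + c s y * ‖w s y‖ ^ 2 + d₃ s y * (θ s y * θ s y)) t x =
      derivWithin (fun τ => a τ x * (r τ x * r τ x) + c τ x * ‖w τ x‖ ^ 2 + d₃ τ x * (θ τ x * θ τ x)) S t
      from rfl, hE.derivWithin (hS t ht)]
  ring

/-- **The pointwise energy identity of the linearised symmetric Euler system.** For arbitrary
jointly smooth fields `r, θ, a, c, g, d₃` (scalar) and `w, v` (vector) on `S × 𝕋^d` (`S` a
time set of unique differentiability), any `b`, with the compatibility of weights `d₃ g = c b` at
`(t, x)`, the energy density `e = a r² + c‖w‖² + d₃θ²` satisfies at `(t, x)`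
`∂ₜe = 2ar·R₁ + 2c⟪w, R₂⟫ + 2d₃θ·R₃ + (∂ₜa)r² + (∂ₜc)‖w‖² + (∂ₜd₃)θ² + r² div(av) + ‖w‖² div(cv)`
` + θ² div(d₃v) + 2r ∑ᵢwᵢ∂ᵢ(ac) + 2θ ∑ᵢwᵢ∂ᵢ(d₃g) - div(ar²v) - div(c‖w‖²v) - div(d₃θ²v)`
` - 2div(acr w) - 2div(d₃gθ w)`,
where `R₁ = ∂ₜr + ∑ᵢvᵢ∂ᵢr + c div w`, `R₂ = ∂ₜw + ∑ᵢvᵢ∂ᵢw + a∇r + b∇θ`,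
`R₃ = ∂ₜθ + ∑ᵢvᵢ∂ᵢθ + g div w` are the residuals of the linearised system (Majda 1984, Ch. 1–2;
Dafermos 2005, (5.1.13)–(5.1.15)). [cite: Majda1984, Ch. 2 §2.1] -/
theorem linearizedEnergy_pointwise (hr : FunctionSpaces.Torus.IsSmoothSpaceTimeOn S r)
    (hθ : FunctionSpaces.Torus.IsSmoothSpaceTimeOn S θ) (hw : FunctionSpaces.Torus.IsSmoothSpaceTimeOn S w)
    (hv : FunctionSpaces.Torus.IsSmoothSpaceTimeOn S v) (ha : FunctionSpaces.Torus.IsSmoothSpaceTimeOn S a)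
    (hc : FunctionSpaces.Torus.IsSmoothSpaceTimeOn S c)
    (hg : FunctionSpaces.Torus.IsSmoothSpaceTimeOn S g) (hd : FunctionSpaces.Torus.IsSmoothSpaceTimeOn S d₃)
    (hS : UniqueDiffOn ℝ S) {t : ℝ} (ht : t ∈ S) (x : UnitAddTorus d)
    (hm : d₃ t x * g t x = c t x * b t x) :
    FunctionSpaces.Torus.timeDerivWithin S
        (fun s y => a s y * r s y ^ 2 + c s y * ‖w s y‖ ^ 2 + d₃ s y * θ s y ^ 2) t x =
      2 * a t x * r t x * (FunctionSpaces.Torus.timeDerivWithin S r t x +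
          (∑ i, v t x i * FunctionSpaces.Torus.partialDeriv i (r t) x) +
          c t x * FunctionSpaces.Torus.divergence (w t) x) +
      2 * c t x * ⟪w t x, FunctionSpaces.Torus.timeDerivWithin S w t x +
          (∑ i, v t x i • FunctionSpaces.Torus.partialDeriv i (w t) x) +
          a t x • FunctionSpaces.Torus.gradient (r t) x + b t x • FunctionSpaces.Torus.gradient (θ t) x⟫_ℝ +
      2 * d₃ t x * θ t x * (FunctionSpaces.Torus.timeDerivWithin S θ t x +
          (∑ i, v t x i * FunctionSpaces.Torus.partialDeriv i (θ t) x) +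
          g t x * FunctionSpaces.Torus.divergence (w t) x) +
      (FunctionSpaces.Torus.timeDerivWithin S a t x * r t x ^ 2 +
        FunctionSpaces.Torus.timeDerivWithin S c t x * ‖w t x‖ ^ 2 +
        FunctionSpaces.Torus.timeDerivWithin S d₃ t x * θ t x ^ 2) +
      (r t x ^ 2 * FunctionSpaces.Torus.divergence (fun y => a t y • v t y) x +
        ‖w t x‖ ^ 2 * FunctionSpaces.Torus.divergence (fun y => c t y • v t y) x +
        θ t x ^ 2 * FunctionSpaces.Torus.divergence (fun y => d₃ t y • v t y) x) +
      2 * r t x * (∑ i, w t x i * FunctionSpaces.Torus.partialDeriv i (fun y => a t y * c t y) x) +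
      2 * θ t x * (∑ i, w t x i * FunctionSpaces.Torus.partialDeriv i (fun y => d₃ t y * g t y) x) -
      FunctionSpaces.Torus.divergence (fun y => (a t y * r t y ^ 2) • v t y) x -
      FunctionSpaces.Torus.divergence (fun y => (c t y * ‖w t y‖ ^ 2) • v t y) x -
      FunctionSpaces.Torus.divergence (fun y => (d₃ t y * θ t y ^ 2) • v t y) x -
      2 * FunctionSpaces.Torus.divergence (fun y => (a t y * c t y * r t y) • w t y) x -
      2 * FunctionSpaces.Torus.divergence (fun y => (d₃ t y * g t y * θ t y) • w t y) x := by
  -- slice regularity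
  have hr1 : FunctionSpaces.Torus.IsContDiff 1 (r t) := (hr.isSmooth_slice ht).isContDiff (by simp)
  have hθ1 : FunctionSpaces.Torus.IsContDiff 1 (θ t) := (hθ.isSmooth_slice ht).isContDiff (by simp)
  have hw1 : FunctionSpaces.Torus.IsContDiff 1 (w t) := (hw.isSmooth_slice ht).isContDiff (by simp)
  have hv1 : FunctionSpaces.Torus.IsContDiff 1 (v t) := (hv.isSmooth_slice ht).isContDiff (by simp)
  have ha1 : FunctionSpaces.Torus.IsContDiff 1 (a t) := (ha.isSmooth_slice ht).isContDiff (by simp)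
  have hc1 : FunctionSpaces.Torus.IsContDiff 1 (c t) := (hc.isSmooth_slice ht).isContDiff (by simp)
  have hg1 : FunctionSpaces.Torus.IsContDiff 1 (g t) := (hg.isSmooth_slice ht).isContDiff (by simp)
  have hd1 : FunctionSpaces.Torus.IsContDiff 1 (d₃ t) := (hd.isSmooth_slice ht).isContDiff (by simp)
  -- the time derivative of the energy density
  have hE := timeDerivWithin_energyDensity hr hθ hw ha hc hd hS ht x
  -- the three transport identities and the two cross-term identities
  have T1 := transport_sq_identity ha1 hr1 hv1 x
  have T2 := transport_norm_sq_identity hc1 hw1 hv1 x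
  have T3 := transport_sq_identity hd1 hθ1 hv1 x
  have hac1 : FunctionSpaces.Torus.IsContDiff 1 (fun y => a t y * c t y) := ha1.mul hc1
  have hdg1 : FunctionSpaces.Torus.IsContDiff 1 (fun y => d₃ t y * g t y) := hd1.mul hg1
  have X1 := cross_identity hac1 hr1 hw1 x
  have X2 := cross_identity hdg1 hθ1 hw1 x
  -- expand the pairing `⟪w, R₂⟫`
  rw [inner_add_right, inner_add_right, inner_add_right, inner_sum, real_inner_smul_right,
    real_inner_smul_right, inner_gradient_eq_sum hr1, inner_gradient_eq_sum hθ1]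
  simp_rw [real_inner_smul_right]
  linear_combination hE - T1 - T2 - T3 - 2 * X1 - 2 * X2 +
    2 * (∑ i, w t x i * FunctionSpaces.Torus.partialDeriv i (θ t) x) * hm

end Pointwise

/-! ## The integrated energy identity -/

section Integrated

variable {d : Type*} [Fintype d] [DecidableEq d] {S : Set ℝ}
  {r θ a b c g d₃ : ℝ → UnitAddTorus d → ℝ} {w v : ℝ → UnitAddTorus d → EuclideanSpace ℝ d}

/-- **The integrated energy identity of the linearised symmetric Euler system.** With the
notation of `linearizedEnergy_pointwise`, on a CONVEX time set `S` and under the compatibility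
`d₃ g = c b` on `{t} × 𝕋^d`, the energy `E(s) = ∫_{𝕋^d} (a r² + c‖w‖² + d₃θ²)(s, x) dx` has the
one-sided derivative within `S` at `t`
`E'(t) = ∫ [2ar R₁ + 2c⟪w, R₂⟫ + 2d₃θ R₃ + (∂ₜa)r² + (∂ₜc)‖w‖² + (∂ₜd₃)θ² + r² div(av)`
` + ‖w‖² div(cv) + θ² div(d₃v) + 2r ∑ᵢwᵢ∂ᵢ(ac) + 2θ ∑ᵢwᵢ∂ᵢ(d₃g)] dx`
— the five divergences integrate to zero on the torus (Majda 1984, Ch. 2 §2.1, the basic energy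
estimate; Dafermos 2005, (5.1.16), (5.1.22)). [cite: Majda1984, Ch. 2 §2.1] -/
theorem linearizedEnergy_hasDerivWithinAt (hr : FunctionSpaces.Torus.IsSmoothSpaceTimeOn S r)
    (hθ : FunctionSpaces.Torus.IsSmoothSpaceTimeOn S θ) (hw : FunctionSpaces.Torus.IsSmoothSpaceTimeOn S w)
    (hv : FunctionSpaces.Torus.IsSmoothSpaceTimeOn S v) (ha : FunctionSpaces.Torus.IsSmoothSpaceTimeOn S a)
    (hc : FunctionSpaces.Torus.IsSmoothSpaceTimeOn S c)
    (hg : FunctionSpaces.Torus.IsSmoothSpaceTimeOn S g) (hd : FunctionSpaces.Torus.IsSmoothSpaceTimeOn S d₃)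
    (hS : Convex ℝ S) (hU : UniqueDiffOn ℝ S) {t : ℝ} (ht : t ∈ S)
    (hm : ∀ x, d₃ t x * g t x = c t x * b t x) :
    HasDerivWithinAt
      (fun s => ∫ x, (a s x * r s x ^ 2 + c s x * ‖w s x‖ ^ 2 + d₃ s x * θ s x ^ 2))
      (∫ x, (2 * a t x * r t x * (FunctionSpaces.Torus.timeDerivWithin S r t x +
          (∑ i, v t x i * FunctionSpaces.Torus.partialDeriv i (r t) x) +
          c t x * FunctionSpaces.Torus.divergence (w t) x) +
        2 * c t x * ⟪w t x, FunctionSpaces.Torus.timeDerivWithin S w t x +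
          (∑ i, v t x i • FunctionSpaces.Torus.partialDeriv i (w t) x) +
          a t x • FunctionSpaces.Torus.gradient (r t) x + b t x • FunctionSpaces.Torus.gradient (θ t) x⟫_ℝ +
        2 * d₃ t x * θ t x * (FunctionSpaces.Torus.timeDerivWithin S θ t x +
          (∑ i, v t x i * FunctionSpaces.Torus.partialDeriv i (θ t) x) +
          g t x * FunctionSpaces.Torus.divergence (w t) x) +
        (FunctionSpaces.Torus.timeDerivWithin S a t x * r t x ^ 2 +
          FunctionSpaces.Torus.timeDerivWithin S c t x * ‖w t x‖ ^ 2 +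
          FunctionSpaces.Torus.timeDerivWithin S d₃ t x * θ t x ^ 2) +
        (r t x ^ 2 * FunctionSpaces.Torus.divergence (fun y => a t y • v t y) x +
          ‖w t x‖ ^ 2 * FunctionSpaces.Torus.divergence (fun y => c t y • v t y) x +
          θ t x ^ 2 * FunctionSpaces.Torus.divergence (fun y => d₃ t y • v t y) x) +
        2 * r t x * (∑ i, w t x i * FunctionSpaces.Torus.partialDeriv i (fun y => a t y * c t y) x) +
        2 * θ t x * (∑ i, w t x i * FunctionSpaces.Torus.partialDeriv i (fun y => d₃ t y * g t y) x)))
      S t := by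
  -- the energy density is a jointly smooth field; differentiate under the integral sign
  have he : FunctionSpaces.Torus.IsSmoothSpaceTimeOn S
      (fun s y => a s y * r s y ^ 2 + c s y * ‖w s y‖ ^ 2 + d₃ s y * θ s y ^ 2) := by
    have hw2 : FunctionSpaces.Torus.IsSmoothSpaceTimeOn S (fun s y => ‖w s y‖ ^ 2) := by
      change ContDiffOn ℝ ∞ (fun z => ‖FunctionSpaces.Torus.stLift w z‖ ^ 2) _
      exact hw.norm_sq ℝ
    have hr2 : FunctionSpaces.Torus.IsSmoothSpaceTimeOn S (fun s y => r s y ^ 2) := hr.pow 2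
    have hθ2 : FunctionSpaces.Torus.IsSmoothSpaceTimeOn S (fun s y => θ s y ^ 2) := hθ.pow 2
    exact ((ha.mul hr2).add (hc.mul hw2)).add (hd.mul hθ2)
  have hD := he.hasDerivWithinAt_integral hS ht
  -- slices are smooth, hence every term below is integrable and every divergence integrates to 0
  have hrs := hr.isSmooth_slice ht
  have hθs := hθ.isSmooth_slice ht
  have hws := hw.isSmooth_slice ht
  have hvs := hv.isSmooth_slice ht
  have has := ha.isSmooth_slice ht
  have hcs := hc.isSmooth_slice ht
  have hgs := hg.isSmooth_slice ht
  have hds := hd.isSmooth_slice ht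
  -- the five divergence fields
  set Φ₁ : UnitAddTorus d → EuclideanSpace ℝ d := fun y => (a t y * r t y ^ 2) • v t y with hΦ₁
  set Φ₂ : UnitAddTorus d → EuclideanSpace ℝ d := fun y => (c t y * ‖w t y‖ ^ 2) • v t y with hΦ₂
  set Φ₃ : UnitAddTorus d → EuclideanSpace ℝ d := fun y => (d₃ t y * θ t y ^ 2) • v t y with hΦ₃
  set Φ₄ : UnitAddTorus d → EuclideanSpace ℝ d := fun y => (a t y * c t y * r t y) • w t y with hΦ₄
  set Φ₅ : UnitAddTorus d → EuclideanSpace ℝ d := fun y => (d₃ t y * g t y * θ t y) • w t y with hΦ₅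
  have h1s : FunctionSpaces.Torus.IsSmooth (fun y => a t y * r t y ^ 2) := has.mul (hrs.pow 2)
  have h2s : FunctionSpaces.Torus.IsSmooth (fun y => c t y * ‖w t y‖ ^ 2) := hcs.mul hws.norm_sq
  have h3s : FunctionSpaces.Torus.IsSmooth (fun y => d₃ t y * θ t y ^ 2) := hds.mul (hθs.pow 2)
  have h4s : FunctionSpaces.Torus.IsSmooth (fun y => a t y * c t y * r t y) := (has.mul hcs).mul hrs
  have h5s : FunctionSpaces.Torus.IsSmooth (fun y => d₃ t y * g t y * θ t y) := (hds.mul hgs).mul hθs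
  have hΦ₁s : FunctionSpaces.Torus.IsSmooth Φ₁ := h1s.smul' hvs
  have hΦ₂s : FunctionSpaces.Torus.IsSmooth Φ₂ := h2s.smul' hvs
  have hΦ₃s : FunctionSpaces.Torus.IsSmooth Φ₃ := h3s.smul' hvs
  have hΦ₄s : FunctionSpaces.Torus.IsSmooth Φ₄ := h4s.smul' hws
  have hΦ₅s : FunctionSpaces.Torus.IsSmooth Φ₅ := h5s.smul' hws
  set D : UnitAddTorus d → ℝ := fun x =>
    FunctionSpaces.Torus.divergence Φ₁ x + FunctionSpaces.Torus.divergence Φ₂ x +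
      FunctionSpaces.Torus.divergence Φ₃ x + 2 * FunctionSpaces.Torus.divergence Φ₄ x +
      2 * FunctionSpaces.Torus.divergence Φ₅ x with hDdef
  have hDint : Integrable D := by
    refine (((hΦ₁s.divergence.integrable.add hΦ₂s.divergence.integrable).add
      hΦ₃s.divergence.integrable).add (hΦ₄s.divergence.integrable.const_mul 2)).add
      (hΦ₅s.divergence.integrable.const_mul 2)
  have hD0 : ∫ x, D x = 0 := by
    have i1 := FunctionSpaces.Torus.integral_divergence_eq_zero_holds hΦ₁s
    have i2 := FunctionSpaces.Torus.integral_divergence_eq_zero_holds hΦ₂s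
    have i3 := FunctionSpaces.Torus.integral_divergence_eq_zero_holds hΦ₃s
    have i4 := FunctionSpaces.Torus.integral_divergence_eq_zero_holds hΦ₄s
    have i5 := FunctionSpaces.Torus.integral_divergence_eq_zero_holds hΦ₅s
    simp only [hDdef]
    rw [integral_add, integral_add, integral_add, integral_add, integral_const_mul, integral_const_mul,
      i1, i2, i3, i4, i5]
    · ring
    · exact hΦ₁s.divergence.integrable
    · exact hΦ₂s.divergence.integrable
    · exact hΦ₁s.divergence.integrable.add hΦ₂s.divergence.integrable
    · exact hΦ₃s.divergence.integrable
    · exact (hΦ₁s.divergence.integrable.add hΦ₂s.divergence.integrable).add hΦ₃s.divergence.integrable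
    · exact hΦ₄s.divergence.integrable.const_mul 2
    · exact ((hΦ₁s.divergence.integrable.add hΦ₂s.divergence.integrable).add
        hΦ₃s.divergence.integrable).add (hΦ₄s.divergence.integrable.const_mul 2)
    · exact hΦ₅s.divergence.integrable.const_mul 2
  -- the time derivative of the energy density is continuous (smooth), hence integrable
  have hEt : FunctionSpaces.Torus.IsSmooth (FunctionSpaces.Torus.timeDerivWithin S
      (fun s y => a s y * r s y ^ 2 + c s y * ‖w s y‖ ^ 2 + d₃ s y * θ s y ^ 2) t) :=
    he.isSmooth_timeDerivWithin hU ht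
  -- rewrite the derivative pointwise and drop the divergences
  refine hD.congr_deriv ?_
  have hpt : ∀ x, FunctionSpaces.Torus.timeDerivWithin S
      (fun s y => a s y * r s y ^ 2 + c s y * ‖w s y‖ ^ 2 + d₃ s y * θ s y ^ 2) t x + D x =
      (2 * a t x * r t x * (FunctionSpaces.Torus.timeDerivWithin S r t x +
          (∑ i, v t x i * FunctionSpaces.Torus.partialDeriv i (r t) x) +
          c t x * FunctionSpaces.Torus.divergence (w t) x) +
        2 * c t x * ⟪w t x, FunctionSpaces.Torus.timeDerivWithin S w t x +
          (∑ i, v t x i • FunctionSpaces.Torus.partialDeriv i (w t) x) +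
          a t x • FunctionSpaces.Torus.gradient (r t) x + b t x • FunctionSpaces.Torus.gradient (θ t) x⟫_ℝ +
        2 * d₃ t x * θ t x * (FunctionSpaces.Torus.timeDerivWithin S θ t x +
          (∑ i, v t x i * FunctionSpaces.Torus.partialDeriv i (θ t) x) +
          g t x * FunctionSpaces.Torus.divergence (w t) x) +
        (FunctionSpaces.Torus.timeDerivWithin S a t x * r t x ^ 2 +
          FunctionSpaces.Torus.timeDerivWithin S c t x * ‖w t x‖ ^ 2 +
          FunctionSpaces.Torus.timeDerivWithin S d₃ t x * θ t x ^ 2) +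
        (r t x ^ 2 * FunctionSpaces.Torus.divergence (fun y => a t y • v t y) x +
          ‖w t x‖ ^ 2 * FunctionSpaces.Torus.divergence (fun y => c t y • v t y) x +
          θ t x ^ 2 * FunctionSpaces.Torus.divergence (fun y => d₃ t y • v t y) x) +
        2 * r t x * (∑ i, w t x i * FunctionSpaces.Torus.partialDeriv i (fun y => a t y * c t y) x) +
        2 * θ t x * (∑ i, w t x i * FunctionSpaces.Torus.partialDeriv i (fun y => d₃ t y * g t y) x)) := by
    intro x
    rw [linearizedEnergy_pointwise hr hθ hw hv ha hc hg hd hU ht x (hm x)]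
    simp only [hDdef, hΦ₁, hΦ₂, hΦ₃, hΦ₄, hΦ₅]
    ring
  have hsum := integral_add hEt.integrable hDint
  rw [hD0, add_zero] at hsum
  rw [← hsum]
  exact integral_congr_ae (Eventually.of_forall hpt)

end Integrated

end CompressibleEuler

end Literature.Analysis.FluidPDE

end
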